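import Literature.Analysis.FluidPDE.FluidComputer.BeltramiDecay
import Literature.Analysis.FluidPDE.FluidComputer.PlanarEnstrophyConservation
import Summits.NavierStokesRegularity.FluidComputer.TaylorGreenAmplitude

/-!
# Single-shell PLANAR fields are exact solutions of every Galerkin truncation: the truncated Lamb
# vector is a gradient, and the planar Taylor–Green vortex decays like `e^{−2νt}` on any mode set
# containing its four modes

HONEST FRAMING (cell `pub-fluidc`, verbatim): *low prior, high value-of-information experiment on
Tao's machine paradigm; NOT a claim that NS blows up.* OUR lemmas about the finite Galerkin system
`IsGalerkinSolution` (the ODE system the cell's two dealiased pseudo-spectral engines step); the only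
literature input is the mechanism they discretise — Taylor 1923 / Majda–Bertozzi 2002, §2.2,
Props. 2.5–2.6 (formalised for the PDE on `ℝ²` in `Literature/Analysis/FluidPDE/PlanarEigenmodeFlows`:
on one Laplacian shell `ψ ↦ J(ψ, Δψ) = 0`, so `v = ∇⊥ψ` is a steady Euler flow and `e^{−Λνt}v` an exact
Navier–Stokes solution) [cite: MajdaBertozziCUP2002, §2.2 Props. 2.5–2.6; Taylor1923] and the
Galerkin system of Doering–Gibbon [cite: DoeringGibbon1995, §5.3 (5.3.12)–(5.3.14)].

`BeltramiDecay` proved the analogous statement for SELF-CURL (Beltrami, 3D) data, where the truncated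
Lamb vector `Σ_{q∈S} û(k−q) × ω̂(q)` vanishes identically. For PLANAR data (`IsPlanar`: horizontal
wavevectors, no vertical component) on ONE shell `|k|² = Λ ≠ 0` it need not vanish, but it is a pure
gradient — mode by mode a multiple of `k` — by the same involution `q ↦ k − q` on the supported triads:

* `shell_rotate` — the pointwise identity behind it: for a planar divergence-free coefficient on the
  shell, `Λ (û₁, −û₀)(a) = (a₀û₁(a) − a₁û₀(a)) (a₀, a₁)` (in 2D, `û(a) ⊥ a` forces `(û₁, −û₀) ∥ a`);
* `rotational_planar_shell` — `Λ · (u × ω)^_S(k)_j = (i/2) Σ_{q∈S} κ(q) κ(k−q) · k_j`,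
  `κ(q) = q₀û₁(q) − q₁û₀(q)` (`ω̂(q) = iκ(q) e_z`);
* `leray_advection_planar_shell` — hence the Leray-projected Galerkin advection term VANISHES: every
  single-shell planar field is a steady state of every truncated Euler system containing its support;
* `planarShellDecay_isGalerkinSolution` — with viscosity, `t ↦ e^{−νΛt} û` solves the unforced Galerkin
  system on `S` EXACTLY for all `t ∈ ℝ`, with an explicit (Bernoulli-type) pressure multiplier;
  `truncEnergy_planarShellDecay`: `E_S(t) = e^{−2νΛt} E_S(0)`;
* the instance both engines ran (the cell's pre-registered planar-eigenmode exactness checks of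
  2026-08-21, dns-A `TG2D` and dns-B `P19`, HOME/STATUS):
  `PlanarTaylorGreen.tg2` = `(sin x cos y, −cos x sin y, 0)` on the shell `|k|² = 2`
  (`isSingleShell_tg2`), `tg2Decay_isGalerkinSolution` on every `S ⊇ planarModes`,
  `truncEnergy_tg2` `E_S(0) = 1/4`, `truncEnergy_tg2Decay` `E_S(t) = e^{−4νt}/4`.

No named facts (D-0026); no statement about the Navier–Stokes PDE is made here.
-/

noncomputable section

namespace Summit.NavierStokesRegularity.FluidComputer

open Complex ComplexConjugate Finset
open scoped BigOperators
open Literature.Analysis.FluidPDE.FluidComputer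
open Literature.Analysis.FluidPDE.FluidComputer.ShellTransfer
open Literature.Analysis.FluidPDE.FluidComputer.ShellTransfer.TaylorGreenHat (scale scale_coeff)
open Summit.NavierStokesRegularity.FluidComputer.TaylorGreenAmplitude (isSingleShell_scale)

namespace PlanarShellDecay

/-- The vertical-vorticity amplitude `κ(a) = a₀ û₁(a) − a₁ û₀(a)` (so that `ω̂(a) = iκ(a) e_z` for a
planar field). [folklore] -/
def kappa (V : FourierVelocity) (a : Fin 3 → ℤ) : ℂ :=
  ((a 0 : ℤ) : ℂ) * V.coeff a 1 - ((a 1 : ℤ) : ℂ) * V.coeff a 0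

section Planar

variable (V : FourierVelocity) (S : Finset (Fin 3 → ℤ)) {Λ : ℝ}
  (hpl : IsPlanar V) (hsh : IsSingleShell V Λ) (hV : ∀ p ∉ S, V.coeff p = 0)

include hpl in
/-- For a planar field the vorticity is vertical: `ω̂(q) = (0, 0, iκ(q))`. [folklore] -/
theorem curl_coeff_planar (q : Fin 3 → ℤ) :
    (curl V).coeff q = ![0, 0, I * kappa V q] := by
  funext j
  fin_cases j
  · simpa using curl_coeff_zero_of_planar hpl q
  · simpa using curl_coeff_one_of_planar hpl q
  · simp [curl_coeff, kappa]

include hpl hsh in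
/-- **The 2D shell identity**: for a planar divergence-free coefficient on the shell `|a|² = Λ`,
`Λ û₁(a) = κ(a) a₀` and `−Λ û₀(a) = κ(a) a₁` (`û(a) ⊥ a` in the plane forces `(û₁, −û₀) ∥ a`); both
sides vanish when `û(a) = 0`. [folklore] -/
theorem shell_rotate (a : Fin 3 → ℤ) :
    (Λ : ℂ) * V.coeff a 1 = kappa V a * ((a 0 : ℤ) : ℂ) ∧
      -((Λ : ℂ) * V.coeff a 0) = kappa V a * ((a 1 : ℤ) : ℂ) := by
  by_cases hz : V.coeff a = 0
  · simp [kappa, hz]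
  · have hΛ : (Λ : ℂ) = ((a 0 : ℤ) : ℂ) ^ 2 + ((a 1 : ℤ) : ℂ) ^ 2 := by
      have h1 : knormSq a = Λ := hsh a hz
      have h2 : a 2 = 0 := hpl.1 a hz
      rw [← h1, knormSq, Fin.sum_univ_three, h2]
      push_cast
      ring
    have hdiv : ((a 0 : ℤ) : ℂ) * V.coeff a 0 + ((a 1 : ℤ) : ℂ) * V.coeff a 1 = 0 := by
      have h := V.divFree a
      rw [Fin.sum_univ_three, hpl.2 a, mul_zero, add_zero] at h
      exact h
    constructor
    · rw [hΛ, kappa]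
      linear_combination ((a 1 : ℤ) : ℂ) * hdiv
    · rw [hΛ, kappa]
      linear_combination (-((a 0 : ℤ) : ℂ)) * hdiv

include hpl in
/-- The third component is consistent too: `κ(a) a₂ = 0` (either `û(a) = 0` or `a₂ = 0`). [folklore] -/
theorem kappa_mul_two (a : Fin 3 → ℤ) : kappa V a * ((a 2 : ℤ) : ℂ) = 0 := by
  by_cases hz : V.coeff a = 0
  · simp [kappa, hz]
  · rw [hpl.1 a hz]; simp

include hpl hsh in
/-- One term of the truncated Lamb vector, multiplied by `Λ`:
`Λ (û(a) × ω̂(q))_j = i κ(q) κ(a) a_j`. [folklore] -/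
theorem shell_ccross (a q : Fin 3 → ℤ) (j : Fin 3) :
    (Λ : ℂ) * ccross (V.coeff a) ((curl V).coeff q) j = I * kappa V q * kappa V a * ((a j : ℤ) : ℂ) := by
  obtain ⟨h1, h0⟩ := shell_rotate V hpl hsh a
  have h2 := kappa_mul_two V hpl a
  rw [curl_coeff_planar V hpl q]
  fin_cases j
  · simp only [ccross, Fin.zero_eta, Fin.isValue, Matrix.cons_val_zero, Matrix.cons_val_one,
      Matrix.cons_val_two, Matrix.head_cons, Matrix.tail_cons]
    linear_combination (I * kappa V q) * h1
  · simp only [ccross, Fin.mk_one, Fin.isValue, Matrix.cons_val_zero, Matrix.cons_val_one,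
      Matrix.cons_val_two, Matrix.head_cons, Matrix.tail_cons]
    linear_combination (I * kappa V q) * h0
  · show (Λ : ℂ) * (V.coeff a 0 * 0 - V.coeff a 1 * 0) = I * kappa V q * kappa V a * ((a 2 : ℤ) : ℂ)
    linear_combination (-(I * kappa V q)) * h2

include hV in
/-- The involution on supported triads: the weights `q_j − (k−q)_j` are odd under `q ↦ k − q`, the
product `κ(q)κ(k−q)` is even and vanishes unless both `q, k−q ∈ S`. [folklore] -/
theorem sum_sub_mul_kappa_eq_zero (k : Fin 3 → ℤ) (j : Fin 3) :
    ∑ q ∈ S, (((q j : ℤ) : ℂ) - (((k - q) j : ℤ) : ℂ)) * (kappa V q * kappa V (k - q)) = 0 := by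
  set T := S.filter (fun q => k - q ∈ S) with hT
  have hκ0 : ∀ p ∉ S, kappa V p = 0 := fun p hp => by simp [kappa, hV p hp]
  have hrestrict : ∑ q ∈ S, (((q j : ℤ) : ℂ) - (((k - q) j : ℤ) : ℂ)) * (kappa V q * kappa V (k - q)) =
      ∑ q ∈ T, (((q j : ℤ) : ℂ) - (((k - q) j : ℤ) : ℂ)) * (kappa V q * kappa V (k - q)) := by
    rw [hT, Finset.sum_filter]
    refine Finset.sum_congr rfl fun q _ => ?_
    split_ifs with h
    · rfl
    · rw [hκ0 (k - q) h]; simp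
  rw [hrestrict]
  refine Finset.sum_involution (fun q _ => k - q) ?_ ?_ ?_ ?_
  · intro q _
    have e : k - (k - q) = q := sub_sub_cancel k q
    rw [e]
    ring
  · intro q _ hne heq
    apply hne
    have e : k - q = q := heq
    rw [e, sub_self, zero_mul]
  · intro q hq
    rw [hT, Finset.mem_filter] at hq ⊢
    refine ⟨hq.2, ?_⟩
    rw [sub_sub_cancel]
    exact hq.1
  · intro q _
    exact sub_sub_cancel k q

include hV in
/-- Consequently `Σ_{q∈S} (k−q)_j κ(q)κ(k−q) = (k_j/2) Σ_{q∈S} κ(q)κ(k−q)`. [folklore] -/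
theorem sum_weight_kappa_eq_half (k : Fin 3 → ℤ) (j : Fin 3) :
    ∑ q ∈ S, (((k - q) j : ℤ) : ℂ) * (kappa V q * kappa V (k - q)) =
      ((k j : ℤ) : ℂ) / 2 * ∑ q ∈ S, kappa V q * kappa V (k - q) := by
  have h := sum_sub_mul_kappa_eq_zero V S hV k j
  have e : ∑ q ∈ S, (((q j : ℤ) : ℂ) - (((k - q) j : ℤ) : ℂ)) * (kappa V q * kappa V (k - q)) =
      ((k j : ℤ) : ℂ) * ∑ q ∈ S, kappa V q * kappa V (k - q) -
        2 * ∑ q ∈ S, (((k - q) j : ℤ) : ℂ) * (kappa V q * kappa V (k - q)) := by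
    rw [Finset.mul_sum, Finset.mul_sum, ← Finset.sum_sub_distrib]
    refine Finset.sum_congr rfl fun q _ => ?_
    simp only [Pi.sub_apply, Int.cast_sub]
    ring
  rw [e] at h
  linear_combination (-1 / 2 : ℂ) * h

/-- The Bernoulli-type scalar `ρ(k) = (i/(2Λ)) Σ_{q∈S} κ(q)κ(k−q)`: the coefficient of `k` in the
truncated Lamb vector. [folklore] -/
def rho (V : FourierVelocity) (S : Finset (Fin 3 → ℤ)) (Λ : ℝ) (k : Fin 3 → ℤ) : ℂ :=
  I / (2 * (Λ : ℂ)) * ∑ q ∈ S, kappa V q * kappa V (k - q)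

include hpl hsh hV in
/-- **The truncated Lamb vector of a single-shell planar field is a gradient**:
`Λ · (u × ω)^_S(k)_j = (i/2) (Σ_{q∈S} κ(q)κ(k−q)) k_j`. [folklore] -/
theorem rotational_planar_shell (k : Fin 3 → ℤ) (j : Fin 3) :
    (Λ : ℂ) * rotational V S k j = I / 2 * (∑ q ∈ S, kappa V q * kappa V (k - q)) * ((k j : ℤ) : ℂ) := by
  unfold rotational
  rw [Finset.mul_sum]
  have hterm : ∀ q ∈ S, (Λ : ℂ) * ccross (V.coeff (k - q)) ((curl V).coeff q) j =
      I * ((((k - q) j : ℤ) : ℂ) * (kappa V q * kappa V (k - q))) := by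
    intro q _
    rw [shell_ccross V hpl hsh (k - q) q j]
    ring
  rw [Finset.sum_congr rfl hterm, ← Finset.mul_sum, sum_weight_kappa_eq_half V S hV k j]
  ring

include hpl hsh hV in
/-- In terms of `ρ`: for `Λ ≠ 0`, `(u × ω)^_S(k)_j = ρ(k) k_j`. [folklore] -/
theorem rotational_eq_rho_mul (hΛ : Λ ≠ 0) (k : Fin 3 → ℤ) (j : Fin 3) :
    rotational V S k j = rho V S Λ k * ((k j : ℤ) : ℂ) := by
  have hΛ' : (Λ : ℂ) ≠ 0 := by exact_mod_cast hΛ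
  have h := rotational_planar_shell V S hpl hsh hV k j
  refine mul_left_cancel₀ hΛ' ?_
  rw [h, rho]
  field_simp

include hpl hsh hV in
/-- **The Galerkin advection term of a single-shell planar field is a pure gradient**:
`N_S(k)_j = (ρ(k) − G(k)) k_j`. [folklore] -/
theorem advection_planar_shell (hΛ : Λ ≠ 0) (k : Fin 3 → ℤ) (j : Fin 3) :
    advection V S k j = (rho V S Λ k - gradPart V S k) * ((k j : ℤ) : ℂ) := by
  have h := rotational_eq V S hV k j
  rw [rotational_eq_rho_mul V S hpl hsh hV hΛ k j] at h
  linear_combination -h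

include hpl hsh hV in
/-- **Its Leray projection vanishes**: a single-shell planar field is a steady state of every truncated
Euler system containing its support. [folklore] -/
theorem leray_advection_planar_shell (hΛ : Λ ≠ 0) (k : Fin 3 → ℤ) :
    leray k (advection V S k) = 0 := by
  have e : advection V S k = fun j => (rho V S Λ k - gradPart V S k) * ((k j : ℤ) : ℂ) :=
    funext fun j => advection_planar_shell V S hpl hsh hV hΛ k j
  rw [e, leray_smul_self]

end Planar

/-! ## The decaying single-shell planar field solves the Galerkin system exactly -/

/-- Planarity is preserved by scaling (the shell is too: `TaylorGreenAmplitude.isSingleShell_scale`).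
[folklore] -/
theorem isPlanar_scale (r : ℝ) {V : FourierVelocity} (hpl : IsPlanar V) : IsPlanar (scale r V) := by
  refine ⟨fun k hk => hpl.1 k fun h => hk ?_, fun k => by rw [scale_coeff, hpl.2 k, mul_zero]⟩
  funext j
  rw [scale_coeff, h]
  simp

/-- **The decaying planar shell field** `t ↦ e^{−νΛt} û` (= `beltramiDecay` run at rate `νΛ`).
[cite: MajdaBertozziCUP2002, Prop. 2.6 eq. (2.26)] -/
def planarShellDecay (V : FourierVelocity) (Λ ν t : ℝ) : FourierVelocity := beltramiDecay V (ν * Λ) t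

/-- `planarShellDecay V Λ ν 0 = V`. [folklore] -/
theorem planarShellDecay_zero (V : FourierVelocity) (Λ ν : ℝ) : planarShellDecay V Λ ν 0 = V :=
  beltramiDecay_zero V (ν * Λ)

/-- It stays supported where `V` is. [folklore] -/
theorem planarShellDecay_isSupportedOn {V : FourierVelocity} {S : Finset (Fin 3 → ℤ)}
    (hV : ∀ p ∉ S, V.coeff p = 0) (Λ ν : ℝ) : IsSupportedOn (fun t => planarShellDecay V Λ ν t) S :=
  beltramiDecay_isSupportedOn hV (ν * Λ)

/-- **Exact Galerkin solution** (the truncated form of MB Prop. 2.6): for a planar field on one shell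
`|k|² = Λ ≠ 0` supported in the finite mode set `S`, `t ↦ e^{−νΛt} û` solves the unforced Galerkin
system on `S` for every viscosity `ν` and all `t ∈ ℝ`, with the pressure multiplier
`c(t,k) = ρ_t(k) − G_t(k)`: the advection term is the gradient `(ρ − G) k`, which the pressure cancels,
and what is left is `dû/dt = −ν|k|²û = −νΛû`. [cite: MajdaBertozziCUP2002, Prop. 2.6 eq. (2.26); DoeringGibbon1995, §5.3 (5.3.13)] -/
theorem planarShellDecay_isGalerkinSolution (V : FourierVelocity) (S : Finset (Fin 3 → ℤ)) {Λ : ℝ}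
    (hpl : IsPlanar V) (hsh : IsSingleShell V Λ) (hΛ : Λ ≠ 0) (hV : ∀ p ∉ S, V.coeff p = 0) (ν : ℝ) :
    IsGalerkinSolution (fun t => planarShellDecay V Λ ν t) S ν
      (fun t k => rho (planarShellDecay V Λ ν t) S Λ k - gradPart (planarShellDecay V Λ ν t) S k)
      (fun _ _ _ => 0) := by
  intro t k _ j
  have hadv : advection (planarShellDecay V Λ ν t) S k j =
      (rho (planarShellDecay V Λ ν t) S Λ k - gradPart (planarShellDecay V Λ ν t) S k) *
        ((k j : ℤ) : ℂ) :=
    advection_planar_shell _ S (isPlanar_scale _ hpl) (isSingleShell_scale _ hsh)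
      (scale_coeff_eq_zero _ V hV) hΛ k j
  have hshell : (knormSq k : ℂ) * V.coeff k j = (Λ : ℂ) * V.coeff k j := by
    by_cases hz : V.coeff k = 0
    · rw [hz]; simp
    · rw [hsh k hz]
  have hrhs : galerkinRHS (planarShellDecay V Λ ν t) S ν
      ((fun t k => rho (planarShellDecay V Λ ν t) S Λ k - gradPart (planarShellDecay V Λ ν t) S k) t)
      ((fun _ _ _ => (0 : ℂ)) t) k j =
        ((-(ν * Λ) * Real.exp (-(ν * Λ) * t) : ℝ) : ℂ) * V.coeff k j := by
    unfold galerkinRHS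
    rw [hadv]
    show -(ν : ℂ) * (knormSq k : ℂ) * (((Real.exp (-(ν * Λ) * t) : ℝ) : ℂ) * V.coeff k j) +
        ((rho (planarShellDecay V Λ ν t) S Λ k - gradPart (planarShellDecay V Λ ν t) S k) *
            ((k j : ℤ) : ℂ) -
          (rho (planarShellDecay V Λ ν t) S Λ k - gradPart (planarShellDecay V Λ ν t) S k) *
            ((k j : ℤ) : ℂ)) + 0 = _
    rw [sub_self, add_zero, add_zero]
    calc -(ν : ℂ) * (knormSq k : ℂ) * (((Real.exp (-(ν * Λ) * t) : ℝ) : ℂ) * V.coeff k j)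
        = -(ν : ℂ) * ((Real.exp (-(ν * Λ) * t) : ℝ) : ℂ) * ((knormSq k : ℂ) * V.coeff k j) := by ring
      _ = ((-(ν * Λ) * Real.exp (-(ν * Λ) * t) : ℝ) : ℂ) * V.coeff k j := by
          rw [hshell]; push_cast; ring
  rw [hrhs]
  have hfun : (fun s => (planarShellDecay V Λ ν s).coeff k j) =
      fun s => ((Real.exp (-(ν * Λ) * s) : ℝ) : ℂ) * V.coeff k j := by
    funext s; rfl
  rw [hfun]
  have hd := ((((hasDerivAt_id' t).const_mul (-(ν * Λ))).exp).ofReal_comp).mul_const (V.coeff k j)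
  refine hd.congr_deriv ?_
  push_cast
  ring

/-- Its energy: `E_S(t) = e^{−2νΛt} E_S(0)`. [cite: MajdaBertozziCUP2002, Prop. 2.6 eq. (2.26)] -/
theorem truncEnergy_planarShellDecay (V : FourierVelocity) (S : Finset (Fin 3 → ℤ)) (Λ ν t : ℝ) :
    truncEnergy (planarShellDecay V Λ ν t) S = Real.exp (-(2 * (ν * Λ)) * t) * truncEnergy V S :=
  truncEnergy_beltramiDecay V S (ν * Λ) t

/-! ## The instance: the planar Taylor–Green vortex on any mode set containing its shell -/

open PlanarTaylorGreen

/-- Off the four modes the coefficients of `tg2` vanish. [folklore] -/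
theorem tg2_coeff_of_not_mem {k : Fin 3 → ℤ} (hk : k ∉ planarModes) : tg2.coeff k = 0 := by
  funext j
  show (if k ∈ planarModes then _ else (0 : ℂ)) = 0
  rw [if_neg hk]

/-- **The planar Taylor–Green vortex lives on the shell `|k|² = 2`.** [folklore] -/
theorem isSingleShell_tg2 : IsSingleShell tg2 2 := by
  intro k hk
  have hmem : k ∈ planarModes := by
    by_contra h
    exact hk (tg2_coeff_of_not_mem h)
  obtain ⟨h0, h1, h2⟩ := mem_planarModes.mp hmem
  rw [knormSq, Fin.sum_univ_three, h2]
  rcases h0 with h0 | h0 <;> rcases h1 with h1 | h1 <;> simp [h0, h1] <;> norm_num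

/-- **The decaying planar Taylor–Green vortex `e^{−2νt}(sin x cos y, −cos x sin y, 0)` solves the
unforced Galerkin system EXACTLY on every finite mode set containing its four modes**, for every
viscosity and all `t ∈ ℝ` — the typed form of the cell's TG2D exactness check (dns-A PREREG-TG2D:
"the engine's dealiased Galerkin truncation + Leray projection + integrating factor inherit it
exactly in exact arithmetic"). [cite: MajdaBertozziCUP2002, Prop. 2.6 eq. (2.26); Taylor1923] -/
theorem tg2Decay_isGalerkinSolution {S : Finset (Fin 3 → ℤ)} (hS : planarModes ⊆ S) (ν : ℝ) :
    IsGalerkinSolution (fun t => planarShellDecay tg2 2 ν t) S ν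
      (fun t k => rho (planarShellDecay tg2 2 ν t) S 2 k - gradPart (planarShellDecay tg2 2 ν t) S k)
      (fun _ _ _ => 0) :=
  planarShellDecay_isGalerkinSolution tg2 S isPlanar_tg2 isSingleShell_tg2 two_ne_zero
    (fun _ hp => tg2_coeff_of_not_mem fun h => hp (hS h)) ν

/-- The Leray-projected advection term of `tg2` vanishes on every `S ⊇ planarModes` (steady truncated
Euler state). [folklore] -/
theorem leray_advection_tg2 {S : Finset (Fin 3 → ℤ)} (hS : planarModes ⊆ S) (k : Fin 3 → ℤ) :
    leray k (advection tg2 S k) = 0 :=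
  leray_advection_planar_shell tg2 S isPlanar_tg2 isSingleShell_tg2
    (fun _ hp => tg2_coeff_of_not_mem fun h => hp (hS h)) two_ne_zero k

/-- Modal energy of `tg2`: `½|û(k)|² = 1/16` on each of the four modes. [folklore] -/
theorem modalEnergy_tg2 {k : Fin 3 → ℤ} (hk : k ∈ planarModes) : modalEnergy tg2 k = 1 / 16 := by
  obtain ⟨h0, h1, -⟩ := mem_planarModes.mp hk
  have e0 : ((k 0 : ℤ) : ℂ) * ((k 0 : ℤ) : ℂ) = 1 := by rcases h0 with h | h <;> simp [h]
  have e1 : ((k 1 : ℤ) : ℂ) * ((k 1 : ℤ) : ℂ) = 1 := by rcases h1 with h | h <;> simp [h]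
  unfold modalEnergy
  have hc : ∀ j, tg2.coeff k j = ![-I * ((k 0 : ℤ) : ℂ) / 4, I * ((k 1 : ℤ) : ℂ) / 4, 0] j := fun j => by
    show (if k ∈ planarModes then _ else (0 : ℂ)) = _
    rw [if_pos hk]
  simp only [Fin.sum_univ_three, hc, Matrix.cons_val_zero, Matrix.cons_val_one, Matrix.cons_val_two,
    Matrix.head_cons, Matrix.tail_cons]
  have n0 : Complex.normSq (-I * ((k 0 : ℤ) : ℂ) / 4) = 1 / 16 := by
    rcases h0 with h | h <;> simp [h, Complex.normSq_apply] <;> norm_num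
  have n1 : Complex.normSq (I * ((k 1 : ℤ) : ℂ) / 4) = 1 / 16 := by
    rcases h1 with h | h <;> simp [h, Complex.normSq_apply] <;> norm_num
  rw [n0, n1]
  simp
  norm_num

/-- **`E_S(tg2) = 1/4`** on every `S ⊇ planarModes` (`= ½⟨|u|²⟩` of `(sin x cos y, −cos x sin y, 0)`).
[folklore] -/
theorem truncEnergy_tg2 {S : Finset (Fin 3 → ℤ)} (hS : planarModes ⊆ S) : truncEnergy tg2 S = 1 / 4 := by
  unfold truncEnergy
  rw [← Finset.sum_subset hS (fun k _ hk => modalEnergy_eq_zero_of_coeff tg2 (tg2_coeff_of_not_mem hk))]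
  rw [Finset.sum_congr rfl fun k hk => modalEnergy_tg2 hk]
  simp [planarModes]
  norm_num

/-- **`E_S(t) = e^{−4νt}/4`** along the decaying planar Taylor–Green vortex, on every `S ⊇ planarModes`
(the reference curve of the TG2D check). [cite: MajdaBertozziCUP2002, Prop. 2.6 eq. (2.26); Taylor1923] -/
theorem truncEnergy_tg2Decay {S : Finset (Fin 3 → ℤ)} (hS : planarModes ⊆ S) (ν t : ℝ) :
    truncEnergy (planarShellDecay tg2 2 ν t) S = Real.exp (-(4 * ν) * t) / 4 := by
  rw [truncEnergy_planarShellDecay, truncEnergy_tg2 hS]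
  ring_nf

end PlanarShellDecay

end Summit.NavierStokesRegularity.FluidComputer
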